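import Summits.QuantumAdvantage.QuantumAdvantage.Theorems.CubicForrelationNearExactIsExactTwelveZ512WindowResidual

/-!
# Crux `CubicForrelation.NearExactIsExact` (stmt-QuantumAdvantage-14043) — n = 12, level-`≥ 6` side with a 9-flat even set:
  the mod-4 SIGN of the residual is AFFINE on the flat, its character sum is `0` or `±512`, supported on `8` frequencies

Certificate seat `b2b-cforr-cert` (gen 27).  HONEST FRAMING: finite-slice lemmas (standard axioms, no `decide` on data) about cubic Boolean
pairs on 12 bits; bricks for closing the level-`≥ 6` × level-`≥ 6` branch of the open window `57/64 < Φ < 29/32` (next file).  They claim NO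
value of `θ₁₂` and are NOT summit progress.

Setting.  Cubic `f, g`, `W_g = 64u''`, `e := u'' − (−1)^f`, `Z := {u'' even} = x_Z ⊕ V₀` a 9-flat (`#V₀ = 512`), `A := {x ∉ Z : 4 ∤ e(x)}`.
Off `Z` the residual is even, so `4·#A ≤ Σ_{x∉Z} e²` (`gh_A_card`).

THE NEW OBSERVATION.  Gen 25's `gh_flat5` says EVERY parametrised 5-flat sum of `e` is `≡ 0 (mod 4)`.  Gens 25/26 used it with TWO
transversal directions (3-flat sums in `Z` mod 4 = (H3), i.e. the sign is quadratic along `Z`).  With THREE transversal directions `t₁, t₂, t₃`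
whose seven non-trivial combinations keep the four points of an inner 2-flat `x ⊕ ⟨a, b⟩ ⊂ Z` away from `Z ∪ A` (a plain counting choice,
possible as soon as `4·(512 + 4·#A) < 4096`, i.e. `#A ≤ 127`, i.e. off-flat energy `≤ 511` — always true on the window, where it is `≤ 383`):
* `tza_two_flat`: `4 ∣ e(x) + e(x⊕a) + e(x⊕b) + e(x⊕a⊕b)` for all `x ∈ Z`, `a, b ∈ V₀`;
* `tza_sign_affine`: hence the mod-4 sign `σ = (−1)^{hb}` of `e` on `Z` (`hb x = [e(x) ≡ 3 (mod 4)]`) has VANISHING second differences along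
  `V₀` — `σ` is affine on the 9-flat (all earlier level-6 analyses only knew it quadratic, (H3));
* `tza_hsd`, `tza_radical_all`: the relative alternating form of `hb` is identically zero (radical `= V₀`);
* `tza_Shat_vals`: the character sums `M(y) = Σ_{x∈Z} σ(x)(−1)^{x·y}` lie in `{0, ±512}` (`d0_Shat_sq` + `gs_SR` with `#R = 512`);
* `tza_Shat_sq_sum`, `tza_Shat_support`: `Σ_y M(y)² = 2^21` (Parseval), so `M ≠ 0` at exactly `8` frequencies.

References: J. Ax (1964) / R. J. McEliece (1972) (divisibility); MacWilliams–Sloane (1977) Ch. 13 §3, Ch. 14 §2; R. O'Donnell (2014) §1.4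
(Parseval).  Axioms: the standard three.
-/

set_option linter.dupNamespace false -- D-0017: single-problem summit ⇒ `QuantumAdvantage.QuantumAdvantage` by design

noncomputable section

namespace Summit.QuantumAdvantage.QuantumAdvantage.Theorems.CubicForrelation.NearExactIsExact

open Finset
open Literature.Computability.QuantumComplexity
open Literature.Computability.QuantumComplexity.BuzetChailloux (bxor zeroVec bxor_bxor_cancel_left bxor_zeroVec zeroVec_bxor bxor_comm
  bxor_self)
open Literature.Computability.QuantumComplexity.DerivativeWalsh (W sum_W_sq)
open Literature.Computability.QuantumComplexity.Simon (twist_eq_one_or)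

/-! ### Three transversal directions avoiding `Z ∪ A` -/

/-- **Three avoiding transversal directions.**  `S = x_Z ⊕ V₀` a 9-flat (`#V₀ = 512`), `A` any set with `#A ≤ 127`, `pt` a family of at
most `4` points of `S` (a parametrised 2-flat); then there are `t₁, t₂, t₃` such that the seven translate families `pt ⊕ t₁`, `pt ⊕ t₂`,
`pt ⊕ t₂ ⊕ t₁`, `pt ⊕ t₃`, `pt ⊕ t₃ ⊕ t₁`, `pt ⊕ t₃ ⊕ t₂`, `pt ⊕ t₃ ⊕ t₂ ⊕ t₁` avoid `S` and `A` (the last step forbids at most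
`4·(512 + 4·127) = 4080 < 4096` vectors). [this work] -/
theorem tza_avoid3 (V₀ S : Finset (Fin (6 + 6) → Bool)) (xZ : Fin (6 + 6) → Bool)
    (hadd : ∀ a ∈ V₀, ∀ b ∈ V₀, bxor a b ∈ V₀) (hcardV : #V₀ = 512) (hS : S = V₀.image (bxor xZ))
    (A : Finset (Fin (6 + 6) → Bool)) (hA : #A ≤ 127)
    {k : ℕ} (hk : 2 ^ k ≤ 4) (pt : (Fin k → Bool) → (Fin (6 + 6) → Bool)) (hpt : ∀ ε, pt ε ∈ S) :
    ∃ t₁ t₂ t₃ : Fin (6 + 6) → Bool, ∀ ε : Fin k → Bool,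
      (bxor (pt ε) t₁ ∉ S ∧ bxor (pt ε) t₁ ∉ A) ∧ (bxor (pt ε) t₂ ∉ S ∧ bxor (pt ε) t₂ ∉ A) ∧
      (bxor (bxor (pt ε) t₂) t₁ ∉ S ∧ bxor (bxor (pt ε) t₂) t₁ ∉ A) ∧ (bxor (pt ε) t₃ ∉ S ∧ bxor (pt ε) t₃ ∉ A) ∧
      (bxor (bxor (pt ε) t₃) t₁ ∉ S ∧ bxor (bxor (pt ε) t₃) t₁ ∉ A) ∧ (bxor (bxor (pt ε) t₃) t₂ ∉ S ∧ bxor (bxor (pt ε) t₃) t₂ ∉ A) ∧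
      (bxor (bxor (bxor (pt ε) t₃) t₂) t₁ ∉ S ∧ bxor (bxor (bxor (pt ε) t₃) t₂) t₁ ∉ A) := by
  classical
  set Bad₀ := (univ : Finset (Fin k → Bool)).biUnion (fun ε => A.image (bxor (pt ε))) with hBad₀
  have hBad₀card : #Bad₀ ≤ 508 := by
    calc #Bad₀ ≤ ∑ ε : Fin k → Bool, #(A.image (bxor (pt ε))) := card_biUnion_le
      _ ≤ ∑ ε : Fin k → Bool, #A := sum_le_sum fun ε _ => card_image_le
      _ = 2 ^ k * #A := by rw [sum_const, card_univ, Fintype.card_fun, Fintype.card_bool, Fintype.card_fin, smul_eq_mul]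
      _ ≤ 4 * 127 := Nat.mul_le_mul hk hA
      _ = 508 := by norm_num
  set F₁ := V₀ ∪ Bad₀ with hF₁
  have hF₁card : #F₁ ≤ 1020 := (card_union_le _ _).trans (by rw [hcardV]; omega)
  have hgood : ∀ w, w ∉ F₁ → ∀ ε, bxor (pt ε) w ∉ S ∧ bxor (pt ε) w ∉ A := by
    intro w hw ε
    rw [hF₁, mem_union, not_or] at hw
    refine ⟨fun h => hw.1 (gh_mem_dir V₀ S xZ hadd hS (hpt ε) h), fun h => hw.2 ?_⟩
    exact mem_biUnion.2 ⟨ε, mem_univ _, mem_image.2 ⟨bxor (pt ε) w, h, bxor_bxor_cancel_left _ _⟩⟩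
  have hshift : ∀ w t : Fin (6 + 6) → Bool, w ∉ F₁.image (fun z => bxor z t) → bxor w t ∉ F₁ := by
    intro w t hw hmem
    exact hw (mem_image.2 ⟨bxor w t, hmem, by rw [iw_bxor_assoc, bxor_self, bxor_zeroVec]⟩)
  have hshift2 : ∀ w t t' : Fin (6 + 6) → Bool, w ∉ F₁.image (fun z => bxor (bxor z t') t) → bxor (bxor w t) t' ∉ F₁ := by
    intro w t t' hw hmem
    exact hw (mem_image.2 ⟨bxor (bxor w t) t', hmem, by
      rw [iw_bxor_assoc (bxor w t), bxor_self, bxor_zeroVec, iw_bxor_assoc, bxor_self, bxor_zeroVec]⟩)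
  have huniv : #(univ : Finset (Fin (6 + 6) → Bool)) = 4096 := by
    rw [card_univ, Fintype.card_fun, Fintype.card_bool, Fintype.card_fin]; norm_num
  obtain ⟨t₁, -, ht₁⟩ : ∃ t, t ∈ univ ∧ t ∉ F₁ := exists_mem_notMem_of_card_lt_card (by rw [huniv]; omega)
  obtain ⟨t₂, -, ht₂⟩ : ∃ t, t ∈ univ ∧ t ∉ F₁ ∪ F₁.image (fun z => bxor z t₁) :=
    exists_mem_notMem_of_card_lt_card (by
      have h1 := card_union_le F₁ (F₁.image (fun z => bxor z t₁))
      have h2 : #(F₁.image (fun z => bxor z t₁)) ≤ 1020 := card_image_le.trans hF₁card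
      rw [huniv]; omega)
  rw [mem_union, not_or] at ht₂
  obtain ⟨t₃, -, ht₃⟩ : ∃ t, t ∈ univ ∧
      t ∉ ((F₁ ∪ F₁.image (fun z => bxor z t₁)) ∪ F₁.image (fun z => bxor z t₂)) ∪ F₁.image (fun z => bxor (bxor z t₁) t₂) :=
    exists_mem_notMem_of_card_lt_card (by
      have h1 := card_union_le F₁ (F₁.image (fun z => bxor z t₁))
      have h2 : #(F₁.image (fun z => bxor z t₁)) ≤ 1020 := card_image_le.trans hF₁card
      have h3 := card_union_le (F₁ ∪ F₁.image (fun z => bxor z t₁)) (F₁.image (fun z => bxor z t₂))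
      have h4 : #(F₁.image (fun z => bxor z t₂)) ≤ 1020 := card_image_le.trans hF₁card
      have h5 := card_union_le ((F₁ ∪ F₁.image (fun z => bxor z t₁)) ∪ F₁.image (fun z => bxor z t₂))
        (F₁.image (fun z => bxor (bxor z t₁) t₂))
      have h6 : #(F₁.image (fun z => bxor (bxor z t₁) t₂)) ≤ 1020 := card_image_le.trans hF₁card
      rw [huniv]; omega)
  simp only [mem_union, not_or] at ht₃
  obtain ⟨⟨⟨ht₃₀, ht₃₁⟩, ht₃₂⟩, ht₃₂₁⟩ := ht₃
  refine ⟨t₁, t₂, t₃, fun ε => ⟨hgood t₁ ht₁ ε, hgood t₂ ht₂.1 ε, ?_, hgood t₃ ht₃₀ ε, ?_, ?_, ?_⟩⟩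
  · rw [iw_bxor_assoc]; exact hgood _ (hshift t₂ t₁ ht₂.2) ε
  · rw [iw_bxor_assoc]; exact hgood _ (hshift t₃ t₁ ht₃₁) ε
  · rw [iw_bxor_assoc]; exact hgood _ (hshift t₃ t₂ ht₃₂) ε
  · rw [iw_bxor_assoc (pt ε), iw_bxor_assoc (pt ε)]
    exact hgood _ (hshift2 t₃ t₂ t₁ ht₃₂₁) ε

/-! ### The 2-flat congruence -/

/-- **Every 2-flat of `Z` has residual sum `≡ 0 (mod 4)`.**  Cubic `f, g`, `W_g = 64u''`, `Z = {u'' even} = x_Z ⊕ V₀` a 9-flat,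
`e = u'' − (−1)^f` with `Σ_{x ∉ Z} e² ≤ 511`: for `x ∈ Z` and `a, b ∈ V₀`, `4 ∣ Σ_{ε∈𝔽₂²} e(x ⊕ ε·(a,b))` (the 5-flat
`x ⊕ ⟨t₁,t₂,t₃,a,b⟩` for three avoiding directions: its 28 outer points are off `Z ∪ A`, where `4 ∣ e`). [this work] -/
theorem tza_two_flat (f g : (Fin (6 + 6) → Bool) → Bool) (hf : IsDegLeFun 3 f) (hg : IsDegLeFun 3 g)
    (u'' : (Fin (6 + 6) → Bool) → ℤ) (hu'' : ∀ x, W (fun y => signOf (g y)) x = (2 : ℝ) ^ 6 * (u'' x : ℝ))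
    (V₀ : Finset (Fin (6 + 6) → Bool)) (xZ : Fin (6 + 6) → Bool) (h0 : zeroVec ∈ V₀)
    (hadd : ∀ a ∈ V₀, ∀ b ∈ V₀, bxor a b ∈ V₀) (hcardV : #V₀ = 512)
    (hS : (univ.filter fun x : Fin (6 + 6) → Bool => ¬ Odd (u'' x)) = V₀.image (bxor xZ))
    (hoff : ∑ y ∈ univ.filter (fun y => y ∉ (univ.filter fun x : Fin (6 + 6) → Bool => ¬ Odd (u'' x))), (u'' y - sZ (f y)) ^ 2 ≤ 511) :
    ∀ x ∈ (univ.filter fun x : Fin (6 + 6) → Bool => ¬ Odd (u'' x)), ∀ a b : Fin (6 + 6) → Bool, a ∈ V₀ → b ∈ V₀ →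
      (4 : ℤ) ∣ ∑ ε : Fin 2 → Bool, (u'' (fun j => x j ^^ decide (Odd #(univ.filter fun i =>
        ε i && (![a, b] : Fin 2 → Fin (6 + 6) → Bool) i j))) - sZ (f (fun j => x j ^^ decide (Odd #(univ.filter fun i =>
        ε i && (![a, b] : Fin 2 → Fin (6 + 6) → Bool) i j))))) := by
  classical
  set Z := univ.filter (fun x : Fin (6 + 6) → Bool => ¬ Odd (u'' x)) with hZdef
  set e : (Fin (6 + 6) → Bool) → ℤ := fun x => u'' x - sZ (f x) with hedef
  intro x hx a b ha hb
  show (4 : ℤ) ∣ ∑ ε : Fin 2 → Bool, e (fun j => x j ^^ decide (Odd #(univ.filter fun i =>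
        ε i && (![a, b] : Fin 2 → Fin (6 + 6) → Bool) i j)))
  set A := (univ.filter fun y : Fin (6 + 6) → Bool => y ∉ Z ∧ ¬ (4 : ℤ) ∣ u'' y - sZ (f y)) with hAdef
  have hAcard : #A ≤ 127 := by
    have h := gh_A_card f u''
    have h' : (4 : ℤ) * #A ≤ 511 := h.trans hoff
    have : (#A : ℤ) ≤ 127 := by omega
    exact_mod_cast this
  have hPV : ∀ x, x ∈ Z → ∀ a ∈ V₀, bxor x a ∈ Z := fun x hx a ha => fl1_coset_vadd hadd hS hx ha
  -- the truncation `F'` agrees with `e` mod 4 and vanishes at the good points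
  set F' : (Fin (6 + 6) → Bool) → ℤ := fun y => if (y ∈ Z ∨ ¬ (4 : ℤ) ∣ e y) then e y else 0 with hF'
  have hdiffF : ∀ y, (4 : ℤ) ∣ e y - F' y := by
    intro y
    by_cases hy : (y ∈ Z ∨ ¬ (4 : ℤ) ∣ e y)
    · simp only [F', if_pos hy, sub_self]; exact dvd_zero _
    · simp only [F', if_neg hy, sub_zero]
      rw [not_or, not_not] at hy
      exact hy.2
  have hF'Z : ∀ y, y ∈ Z → F' y = e y := fun y hy => by simp only [F', if_pos (Or.inl hy)]
  have hGF : ∀ y, y ∉ Z → y ∉ A → F' y = 0 := by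
    intro y hy hyA
    have h4 : (4 : ℤ) ∣ e y := by
      by_contra h4
      exact hyA (mem_filter.2 ⟨mem_univ _, hy, h4⟩)
    simp only [F']
    rw [if_neg]
    rw [not_or, not_not]
    exact ⟨hy, h4⟩
  -- the inner 2-flat and three avoiding directions
  set pt : (Fin 2 → Bool) → (Fin (6 + 6) → Bool) :=
    fun ε => (fun j => x j ^^ decide (Odd #(univ.filter fun i => ε i && (![a, b] : Fin 2 → Fin (6 + 6) → Bool) i j))) with hptdef
  have hin : ∀ ε, pt ε ∈ Z := fun ε => st4_mem_flatPt2 V₀ h0 (· ∈ Z) hPV hx ![a, b] (fun i => by fin_cases i <;> assumption) ε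
  obtain ⟨t₁, t₂, t₃, hgood⟩ := tza_avoid3 V₀ Z xZ hadd hcardV hS A hAcard (k := 2) (by norm_num) pt hin
  have hloc := ep_loc3 F' x t₁ t₂ t₃ ![a, b]
    (fun ε => hGF _ (hgood ε).1.1 (hgood ε).1.2) (fun ε => hGF _ (hgood ε).2.1.1 (hgood ε).2.1.2)
    (fun ε => hGF _ (hgood ε).2.2.1.1 (hgood ε).2.2.1.2) (fun ε => hGF _ (hgood ε).2.2.2.1.1 (hgood ε).2.2.2.1.2)
    (fun ε => hGF _ (hgood ε).2.2.2.2.1.1 (hgood ε).2.2.2.2.1.2) (fun ε => hGF _ (hgood ε).2.2.2.2.2.1.1 (hgood ε).2.2.2.2.2.1.2)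
    (fun ε => hGF _ (hgood ε).2.2.2.2.2.2.1 (hgood ε).2.2.2.2.2.2.2)
  -- the 5-flat sum of `F'` is `≡ 0 (mod 4)`
  have h5 := gh_flat5 f g hf hg u'' hu'' x ![t₁, t₂, t₃, a, b]
  have h5' : (4 : ℤ) ∣ ∑ ε : Fin 5 → Bool, F' (fun j => x j ^^ decide (Odd #(univ.filter fun i =>
      ε i && (![t₁, t₂, t₃, a, b] : Fin 5 → Fin (6 + 6) → Bool) i j))) := by
    have hd : (4 : ℤ) ∣ ∑ ε : Fin 5 → Bool, ((u'' (fun j => x j ^^ decide (Odd #(univ.filter fun i =>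
        ε i && (![t₁, t₂, t₃, a, b] : Fin 5 → Fin (6 + 6) → Bool) i j))) - sZ (f (fun j => x j ^^ decide (Odd #(univ.filter fun i =>
        ε i && (![t₁, t₂, t₃, a, b] : Fin 5 → Fin (6 + 6) → Bool) i j))))) -
        F' (fun j => x j ^^ decide (Odd #(univ.filter fun i =>
        ε i && (![t₁, t₂, t₃, a, b] : Fin 5 → Fin (6 + 6) → Bool) i j)))) := dvd_sum fun ε _ => hdiffF _
    rw [sum_sub_distrib] at hd
    have := dvd_sub h5 hd
    simpa using this
  have e5 : (![t₁, t₂, t₃, a, b] : Fin 5 → Fin (6 + 6) → Bool) =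
      Matrix.vecCons t₁ (Matrix.vecCons t₂ (Matrix.vecCons t₃ ![a, b])) := rfl
  rw [e5, hloc] at h5'
  rw [sum_congr rfl fun ε _ => hF'Z _ (hin ε)] at h5'
  exact h5'

/-! ### The mod-4 sign is affine on `Z` -/

/-- Four signs summing to `0 mod 4` have an even number of `−1`s. [folklore] -/
theorem tza_xor4_of_dvd {b₀ b₁ b₂ b₃ : Bool} (h : (4 : ℤ) ∣ sZ b₀ + sZ b₁ + sZ b₂ + sZ b₃) :
    (b₀ ^^ b₁ ^^ b₂ ^^ b₃) = false := by
  revert h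
  revert b₀ b₁ b₂ b₃
  decide

/-- On `Z` the residual is `≡ σ (mod 4)` with `σ = sZ [e ≡ 3 (mod 4)]`. [folklore] -/
theorem tza_mod4 (f : (Fin (6 + 6) → Bool) → Bool) (u'' : (Fin (6 + 6) → Bool) → ℤ)
    {x : Fin (6 + 6) → Bool} (hx : x ∈ (univ.filter fun x : Fin (6 + 6) → Bool => ¬ Odd (u'' x))) :
    (4 : ℤ) ∣ (u'' x - sZ (f x)) - sZ (decide ((u'' x - sZ (f x)) % 4 = 3)) := by
  have hev := Int.not_odd_iff_even.1 (mem_filter.1 hx).2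
  have hodd : Odd (u'' x - sZ (f x)) := by
    rcases tp_sZ_cases (f x) with hs | hs <;> rw [hs]
    · exact Int.odd_sub.2 (iff_of_false (Int.not_odd_iff_even.2 hev) (by decide))
    · exact Int.odd_sub.2 (iff_of_false (Int.not_odd_iff_even.2 hev) (by decide))
  have ho := Int.odd_iff.1 hodd
  by_cases h3 : (u'' x - sZ (f x)) % 4 = 3
  · rw [decide_eq_true h3, show sZ true = -1 from rfl]; omega
  · rw [decide_eq_false h3, show sZ false = 1 from rfl]; omega

/-- **The mod-4 sign of the residual is AFFINE on the 9-flat.**  Cubic `f, g`, `W_g = 64u''`, `Z = {u'' even} = x_Z ⊕ V₀` a 9-flat,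
`Σ_{x ∉ Z} e² ≤ 511`, `hb x = [e(x) ≡ 3 (mod 4)]`: for `x ∈ Z`, `p, q ∈ V₀`, `hb(x ⊕ p ⊕ q) = hb(x) ⊕ hb(x⊕p) ⊕ hb(x⊕q)`.
[this work] -/
theorem tza_sign_affine (f g : (Fin (6 + 6) → Bool) → Bool) (hf : IsDegLeFun 3 f) (hg : IsDegLeFun 3 g)
    (u'' : (Fin (6 + 6) → Bool) → ℤ) (hu'' : ∀ x, W (fun y => signOf (g y)) x = (2 : ℝ) ^ 6 * (u'' x : ℝ))
    (V₀ : Finset (Fin (6 + 6) → Bool)) (xZ : Fin (6 + 6) → Bool) (h0 : zeroVec ∈ V₀)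
    (hadd : ∀ a ∈ V₀, ∀ b ∈ V₀, bxor a b ∈ V₀) (hcardV : #V₀ = 512)
    (hS : (univ.filter fun x : Fin (6 + 6) → Bool => ¬ Odd (u'' x)) = V₀.image (bxor xZ))
    (hoff : ∑ y ∈ univ.filter (fun y => y ∉ (univ.filter fun x : Fin (6 + 6) → Bool => ¬ Odd (u'' x))), (u'' y - sZ (f y)) ^ 2 ≤ 511) :
    ∀ x ∈ (univ.filter fun x : Fin (6 + 6) → Bool => ¬ Odd (u'' x)), ∀ p ∈ V₀, ∀ q ∈ V₀,
      decide ((u'' (bxor (bxor x p) q) - sZ (f (bxor (bxor x p) q))) % 4 = 3) =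
        (decide ((u'' x - sZ (f x)) % 4 = 3) ^^ decide ((u'' (bxor x p) - sZ (f (bxor x p))) % 4 = 3) ^^
          decide ((u'' (bxor x q) - sZ (f (bxor x q))) % 4 = 3)) := by
  classical
  set Z := univ.filter (fun x : Fin (6 + 6) → Bool => ¬ Odd (u'' x)) with hZdef
  set e : (Fin (6 + 6) → Bool) → ℤ := fun x => u'' x - sZ (f x) with hedef
  set hb : (Fin (6 + 6) → Bool) → Bool := fun x => decide (e x % 4 = 3) with hbdef
  intro x hx p hp q hq
  show hb (bxor (bxor x p) q) = (hb x ^^ hb (bxor x p) ^^ hb (bxor x q))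
  have hPV : ∀ x, x ∈ Z → ∀ a ∈ V₀, bxor x a ∈ Z := fun x hx a ha => fl1_coset_vadd hadd hS hx ha
  have h2 := tza_two_flat f g hf hg u'' hu'' V₀ xZ h0 hadd hcardV hS hoff x hx q p hq hp
  rw [st4_sum2 e x q p] at h2
  have hm : ∀ z ∈ Z, ∃ k : ℤ, e z = sZ (hb z) + 4 * k := by
    intro z hz
    obtain ⟨k, hk⟩ := tza_mod4 f u'' hz
    exact ⟨k, by simp only [hb, e]; linarith⟩
  obtain ⟨k₀, hk₀⟩ := hm x hx
  obtain ⟨k₁, hk₁⟩ := hm (bxor x q) (hPV x hx q hq)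
  obtain ⟨k₂, hk₂⟩ := hm (bxor x p) (hPV x hx p hp)
  obtain ⟨k₃, hk₃⟩ := hm (bxor (bxor x p) q) (hPV _ (hPV x hx p hp) q hq)
  rw [hk₀, hk₁, hk₂, hk₃] at h2
  have h4 : (4 : ℤ) ∣ sZ (hb x) + sZ (hb (bxor x q)) + sZ (hb (bxor x p)) + sZ (hb (bxor (bxor x p) q)) := by
    have : sZ (hb x) + sZ (hb (bxor x q)) + sZ (hb (bxor x p)) + sZ (hb (bxor (bxor x p) q)) =
        (sZ (hb x) + 4 * k₀ + (sZ (hb (bxor x q)) + 4 * k₁) + (sZ (hb (bxor x p)) + 4 * k₂) +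
          (sZ (hb (bxor (bxor x p) q)) + 4 * k₃)) - 4 * (k₀ + k₁ + k₂ + k₃) := by ring
    rw [this]
    exact dvd_sub h2 (dvd_mul_right 4 _)
  have X := tza_xor4_of_dvd h4
  revert X
  generalize hb x = A₀
  generalize hb (bxor x q) = A₁
  generalize hb (bxor x p) = A₂
  generalize hb (bxor (bxor x p) q) = A₃
  revert A₀ A₁ A₂ A₃
  decide

/-- **`hsd` form** (the input of the radical machine): base-free second differences with the relative form of `hb` at `x_Z`, which here
vanishes identically. [this work] -/
theorem tza_hsd (f g : (Fin (6 + 6) → Bool) → Bool) (hf : IsDegLeFun 3 f) (hg : IsDegLeFun 3 g)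
    (u'' : (Fin (6 + 6) → Bool) → ℤ) (hu'' : ∀ x, W (fun y => signOf (g y)) x = (2 : ℝ) ^ 6 * (u'' x : ℝ))
    (V₀ : Finset (Fin (6 + 6) → Bool)) (xZ : Fin (6 + 6) → Bool) (h0 : zeroVec ∈ V₀)
    (hadd : ∀ a ∈ V₀, ∀ b ∈ V₀, bxor a b ∈ V₀) (hcardV : #V₀ = 512)
    (hS : (univ.filter fun x : Fin (6 + 6) → Bool => ¬ Odd (u'' x)) = V₀.image (bxor xZ))
    (hoff : ∑ y ∈ univ.filter (fun y => y ∉ (univ.filter fun x : Fin (6 + 6) → Bool => ¬ Odd (u'' x))), (u'' y - sZ (f y)) ^ 2 ≤ 511) :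
    (∀ p ∈ V₀, ∀ q ∈ V₀, (decide ((u'' xZ - sZ (f xZ)) % 4 = 3) ^^ decide ((u'' (bxor xZ p) - sZ (f (bxor xZ p))) % 4 = 3) ^^
        decide ((u'' (bxor xZ q) - sZ (f (bxor xZ q))) % 4 = 3) ^^ decide ((u'' (bxor (bxor xZ p) q) - sZ (f (bxor (bxor xZ p) q))) % 4 = 3)) = false) ∧
    ∀ x, x ∈ (univ.filter fun x : Fin (6 + 6) → Bool => ¬ Odd (u'' x)) → ∀ p ∈ V₀, ∀ q ∈ V₀,
      decide ((u'' (bxor (bxor x p) q) - sZ (f (bxor (bxor x p) q))) % 4 = 3) =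
        (decide ((u'' x - sZ (f x)) % 4 = 3) ^^ decide ((u'' (bxor x p) - sZ (f (bxor x p))) % 4 = 3) ^^
          decide ((u'' (bxor x q) - sZ (f (bxor x q))) % 4 = 3) ^^
          (decide ((u'' xZ - sZ (f xZ)) % 4 = 3) ^^ decide ((u'' (bxor xZ p) - sZ (f (bxor xZ p))) % 4 = 3) ^^
            decide ((u'' (bxor xZ q) - sZ (f (bxor xZ q))) % 4 = 3) ^^ decide ((u'' (bxor (bxor xZ p) q) - sZ (f (bxor (bxor xZ p) q))) % 4 = 3))) := by
  classical
  set hb : (Fin (6 + 6) → Bool) → Bool := fun x => decide ((u'' x - sZ (f x)) % 4 = 3) with hbdef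
  have haff := tza_sign_affine f g hf hg u'' hu'' V₀ xZ h0 hadd hcardV hS hoff
  have hxZ : xZ ∈ (univ.filter fun x : Fin (6 + 6) → Bool => ¬ Odd (u'' x)) := by
    rw [hS]; exact mem_image.2 ⟨zeroVec, h0, bxor_zeroVec xZ⟩
  have hB : ∀ p ∈ V₀, ∀ q ∈ V₀, (hb xZ ^^ hb (bxor xZ p) ^^ hb (bxor xZ q) ^^ hb (bxor (bxor xZ p) q)) = false := by
    intro p hp q hq
    have h := haff xZ hxZ p hp q hq
    change hb (bxor (bxor xZ p) q) = (hb xZ ^^ hb (bxor xZ p) ^^ hb (bxor xZ q)) at h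
    rw [h]
    cases hb xZ <;> cases hb (bxor xZ p) <;> cases hb (bxor xZ q) <;> rfl
  refine ⟨hB, fun x hx p hp q hq => ?_⟩
  have h := haff x hx p hp q hq
  change hb (bxor (bxor x p) q) = (hb x ^^ hb (bxor x p) ^^ hb (bxor x q)) at h
  show hb (bxor (bxor x p) q) = (hb x ^^ hb (bxor x p) ^^ hb (bxor x q) ^^ (hb xZ ^^ hb (bxor xZ p) ^^ hb (bxor xZ q) ^^ hb (bxor (bxor xZ p) q)))
  rw [hB p hp q hq, h, Bool.xor_false]

/-- **The radical is all of `V₀`** (the relative form vanishes): the filter of the radical machine equals `V₀`. [this work] -/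
theorem tza_radical_all (f g : (Fin (6 + 6) → Bool) → Bool) (hf : IsDegLeFun 3 f) (hg : IsDegLeFun 3 g)
    (u'' : (Fin (6 + 6) → Bool) → ℤ) (hu'' : ∀ x, W (fun y => signOf (g y)) x = (2 : ℝ) ^ 6 * (u'' x : ℝ))
    (V₀ : Finset (Fin (6 + 6) → Bool)) (xZ : Fin (6 + 6) → Bool) (h0 : zeroVec ∈ V₀)
    (hadd : ∀ a ∈ V₀, ∀ b ∈ V₀, bxor a b ∈ V₀) (hcardV : #V₀ = 512)
    (hS : (univ.filter fun x : Fin (6 + 6) → Bool => ¬ Odd (u'' x)) = V₀.image (bxor xZ))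
    (hoff : ∑ y ∈ univ.filter (fun y => y ∉ (univ.filter fun x : Fin (6 + 6) → Bool => ¬ Odd (u'' x))), (u'' y - sZ (f y)) ^ 2 ≤ 511) :
    (V₀.filter fun r => ∀ v ∈ V₀, (decide ((u'' xZ - sZ (f xZ)) % 4 = 3) ^^ decide ((u'' (bxor xZ r) - sZ (f (bxor xZ r))) % 4 = 3) ^^
        decide ((u'' (bxor xZ v) - sZ (f (bxor xZ v))) % 4 = 3) ^^ decide ((u'' (bxor (bxor xZ r) v) - sZ (f (bxor (bxor xZ r) v))) % 4 = 3)) = false) = V₀ := by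
  obtain ⟨hB, -⟩ := tza_hsd f g hf hg u'' hu'' V₀ xZ h0 hadd hcardV hS hoff
  exact filter_true_of_mem fun r hr v hv => hB r hr v hv

/-! ### The character sums of the sign on `Z` -/

/-- **The sign character sums are `0` or `±512`.**  Cubic `f, g`, `W_g = 64u''`, `Z = {u'' even} = x_Z ⊕ V₀` a 9-flat,
`Σ_{x ∉ Z} e² ≤ 511`, `σ = (−1)^{hb}` the mod-4 sign of `e` on `Z`: for every `y`, `M(y) = Σ_{x∈Z} σ(x)(−1)^{x·y} ∈ {0, 512, −512}`
(`M² = 512·S_R` by `d0_Shat_sq`, `S_R ∈ {0, #R}` by `gs_SR`, `R = V₀`). [this work] -/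
theorem tza_Shat_vals (f g : (Fin (6 + 6) → Bool) → Bool) (hf : IsDegLeFun 3 f) (hg : IsDegLeFun 3 g)
    (u'' : (Fin (6 + 6) → Bool) → ℤ) (hu'' : ∀ x, W (fun y => signOf (g y)) x = (2 : ℝ) ^ 6 * (u'' x : ℝ))
    (V₀ : Finset (Fin (6 + 6) → Bool)) (xZ : Fin (6 + 6) → Bool) (h0 : zeroVec ∈ V₀)
    (hadd : ∀ a ∈ V₀, ∀ b ∈ V₀, bxor a b ∈ V₀) (hcardV : #V₀ = 512)
    (hS : (univ.filter fun x : Fin (6 + 6) → Bool => ¬ Odd (u'' x)) = V₀.image (bxor xZ))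
    (hoff : ∑ y ∈ univ.filter (fun y => y ∉ (univ.filter fun x : Fin (6 + 6) → Bool => ¬ Odd (u'' x))), (u'' y - sZ (f y)) ^ 2 ≤ 511)
    (y : Fin (6 + 6) → Bool) :
    ∑ x ∈ (univ.filter fun x : Fin (6 + 6) → Bool => ¬ Odd (u'' x)), signOf (decide ((u'' x - sZ (f x)) % 4 = 3)) * twist x y = 0 ∨
    ∑ x ∈ (univ.filter fun x : Fin (6 + 6) → Bool => ¬ Odd (u'' x)), signOf (decide ((u'' x - sZ (f x)) % 4 = 3)) * twist x y = 512 ∨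
    ∑ x ∈ (univ.filter fun x : Fin (6 + 6) → Bool => ¬ Odd (u'' x)), signOf (decide ((u'' x - sZ (f x)) % 4 = 3)) * twist x y = -512 := by
  classical
  set hb : (Fin (6 + 6) → Bool) → Bool := fun x => decide ((u'' x - sZ (f x)) % 4 = 3) with hbdef
  obtain ⟨-, hsd⟩ := tza_hsd f g hf hg u'' hu'' V₀ xZ h0 hadd hcardV hS hoff
  have hRall := tza_radical_all f g hf hg u'' hu'' V₀ xZ h0 hadd hcardV hS hoff
  change (V₀.filter fun r => ∀ v ∈ V₀, (hb xZ ^^ hb (bxor xZ r) ^^ hb (bxor xZ v) ^^ hb (bxor (bxor xZ r) v)) = false) = V₀ at hRall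
  have hSq := d0_Shat_sq V₀ u'' xZ h0 hadd hcardV hS hb hsd y
  have hSR := gs_SR V₀ u'' xZ h0 hadd hS hb hsd y
  rw [hRall, hcardV] at hSR
  rw [hRall] at hSq
  set M := ∑ x ∈ (univ.filter fun x : Fin (6 + 6) → Bool => ¬ Odd (u'' x)), signOf (hb x) * twist x y with hM
  rcases hSR with h | h
  · rw [h, mul_zero] at hSq
    exact Or.inl (pow_eq_zero_iff two_ne_zero |>.1 hSq)
  · rw [h] at hSq
    push_cast at hSq
    have h2 : (M - 512) * (M + 512) = 0 := by nlinarith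
    rcases mul_eq_zero.1 h2 with h3 | h3
    · exact Or.inr (Or.inl (by linarith))
    · exact Or.inr (Or.inr (by linarith))

/-- **Parseval for the sign on `Z`**: `Σ_y M(y)² = 4096 · 512`. [folklore; cite: R. O'Donnell (2014) §1.4] -/
theorem tza_Shat_sq_sum (u'' : (Fin (6 + 6) → Bool) → ℤ) (hb : (Fin (6 + 6) → Bool) → Bool)
    (hZ : #(univ.filter fun x : Fin (6 + 6) → Bool => ¬ Odd (u'' x)) = 512) :
    ∑ y, (∑ x ∈ (univ.filter fun x : Fin (6 + 6) → Bool => ¬ Odd (u'' x)), signOf (hb x) * twist x y) ^ 2 = 4096 * 512 := by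
  classical
  set Z := univ.filter (fun x : Fin (6 + 6) → Bool => ¬ Odd (u'' x)) with hZdef
  set Sr : (Fin (6 + 6) → Bool) → ℝ := fun x => if x ∈ Z then signOf (hb x) else 0 with hSr
  have hW : ∀ y, W Sr y = ∑ x ∈ Z, signOf (hb x) * twist x y := by
    intro y
    unfold W
    rw [← sum_filter_add_sum_filter_not univ (fun x => x ∈ Z)]
    have hz : ∑ x ∈ univ.filter (fun x => x ∉ Z), Sr x * twist x y = 0 :=
      sum_eq_zero fun x hx => by simp only [Sr, if_neg (mem_filter.1 hx).2, zero_mul]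
    rw [hz, add_zero]
    have ef : univ.filter (fun x => x ∈ Z) = Z := by ext x; simp
    rw [ef]
    exact sum_congr rfl fun x hx => by simp only [Sr, if_pos hx]
  have hP := sum_W_sq Sr
  simp_rw [hW] at hP
  rw [hP]
  have hsq : ∑ x, Sr x ^ 2 = 512 := by
    rw [← sum_filter_add_sum_filter_not univ (fun x => x ∈ Z)]
    have hz : ∑ x ∈ univ.filter (fun x => x ∉ Z), Sr x ^ 2 = 0 :=
      sum_eq_zero fun x hx => by simp only [Sr, if_neg (mem_filter.1 hx).2]; ring
    rw [hz, add_zero]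
    have ef : univ.filter (fun x => x ∈ Z) = Z := by ext x; simp
    rw [ef]
    have h1 : ∀ x ∈ Z, Sr x ^ 2 = 1 := fun x hx => by
      simp only [Sr, if_pos hx]; cases hb x <;> simp [signOf]
    rw [sum_congr rfl h1, sum_const, hZ]; norm_num
  rw [hsq]; norm_num

/-- **Exactly `8` non-zero sign character sums.**  With `M(y) ∈ {0, ±512}` for all `y` and `Σ_y M(y)² = 2^21`:
`#{y : M(y) ≠ 0} = 8`. [this work] -/
theorem tza_Shat_support (u'' : (Fin (6 + 6) → Bool) → ℤ) (hb : (Fin (6 + 6) → Bool) → Bool)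
    (hZ : #(univ.filter fun x : Fin (6 + 6) → Bool => ¬ Odd (u'' x)) = 512)
    (hvals : ∀ y, ∑ x ∈ (univ.filter fun x : Fin (6 + 6) → Bool => ¬ Odd (u'' x)), signOf (hb x) * twist x y = 0 ∨
      ∑ x ∈ (univ.filter fun x : Fin (6 + 6) → Bool => ¬ Odd (u'' x)), signOf (hb x) * twist x y = 512 ∨
      ∑ x ∈ (univ.filter fun x : Fin (6 + 6) → Bool => ¬ Odd (u'' x)), signOf (hb x) * twist x y = -512) :
    #(univ.filter fun y : Fin (6 + 6) → Bool =>
      ∑ x ∈ (univ.filter fun x : Fin (6 + 6) → Bool => ¬ Odd (u'' x)), signOf (hb x) * twist x y ≠ 0) = 8 := by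
  classical
  set Z := univ.filter (fun x : Fin (6 + 6) → Bool => ¬ Odd (u'' x)) with hZdef
  set M : (Fin (6 + 6) → Bool) → ℝ := fun y => ∑ x ∈ Z, signOf (hb x) * twist x y with hM
  have hP := tza_Shat_sq_sum u'' hb hZ
  change ∑ y, M y ^ 2 = 4096 * 512 at hP
  have hpt : ∀ y, M y ^ 2 = if M y ≠ 0 then (512 : ℝ) ^ 2 else 0 := by
    intro y
    rcases hvals y with h | h | h
    · change M y = 0 at h; rw [h]; simp
    · change M y = 512 at h; rw [h]; norm_num
    · change M y = -512 at h; rw [h]; norm_num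
  rw [sum_congr rfl fun y _ => hpt y, ← sum_filter, sum_const, nsmul_eq_mul] at hP
  have h8 : (#(univ.filter fun y => M y ≠ 0) : ℝ) = 8 := by nlinarith
  exact_mod_cast h8

end Summit.QuantumAdvantage.QuantumAdvantage.Theorems.CubicForrelation.NearExactIsExact

end
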